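import Literature.NumberTheory.Automorphic.ShimuraCurveRibetTakahashiNumeratorProofs
import Literature.NumberTheory.EllipticCurves.RationalIsogenyDegrees
import Literature.NumberTheory.EllipticCurves.PastenHeightBoundsLemma68LocalProofs
import Literature.NumberTheory.EllipticCurves.MultiplicativeComponentGroupOrder
import HarnessLib

/-!
# The image and cokernel orders `i_p(D,M)`, `j_p(D,M)` of the optimal quotient on Néron component
# groups: Ribet–Takahashi's degree comparison (Pasten 2024 Prop. 6.13 = Ribet–Takahashi 1997
# Thm. 2), the Eisenstein property of the image (Lemma 6.14), the Papikian–Rabinoff bound on the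
# cokernel (Lemma 6.18), and the functoriality of `Φ_p` under isogenies (Lemma 6.8) — TYPED
# STATEMENTS (named facts, D-0014) over the tree's Shimura-curve vocabulary

Topic `NumberTheory/Automorphic`; companion of `ShimuraCurveRibetTakahashi.lean` (named facts of
H. Pasten, *Shimura curves and the abc conjecture*, J. Number Theory 254 (2024) 214–335 =
arXiv:1705.09251 [PastenShimura2024]) and of its proofs files. SOURCE READ on the held arXiv text
`paper:arxiv-1705.09251` (page = chunk `pNNNN`): §6.1 (p0020), §6.4 and Lemma 6.8 (p0022), §6.6,
Prop. 6.13 and Lemma 6.14 (p0023), Lemmas 6.15–6.18 and Thm. 6.17 (p0024), §6.9 (p0025);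
bibliography (p0066): [RiTa] = Ribet–Takahashi, PNAS 94 (1997) 11110–11114; [RibetEisenstein] =
K. Ribet, *On the component groups and the Shimura subgroup of `J₀(N)`*, Sém. Théor. Nombres
Bordeaux 1987–88, exp. 6; [PaRa] = Papikian–Rabinoff, Canad. J. Math. 68 (2016). Secondary read
(held): S. Takahashi, J. Number Theory 90 (2001) 74–88, pp. 75–76 (restates [RiTa]).

## Why this file

Two lines of the tree consume exactly these statements as HYPOTHESES because the tree has no
Néron models, hence no component groups `Φ_p(J₀^D(M))`, `Φ_p(A_{D,M})` and no map `q_{D,M,p,*}`: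

* the `abc` line (`Summits/ABC`, Pasten Thm. 6.1 / 6.1 (b) / the two-prime package): the proofs
  files `ShimuraCurveRibetTakahashiNumeratorProofs.lean` (`eqSequentially_of_prop_6_13_of_lemma_6_8`,
  hypotheses `h613`, `h68`), `ShimuraCurveRibetTakahashiPairwiseDenominatorProofs.lean`
  (`PastenShimura2024_thm_6_1_b_of_ribetTakahashi_eisenstein_mazurKenku'`, hypotheses `cI cJ hI hJ
  h613 hJc hEis`), whose docstrings say verbatim that the discharge "waits exactly for the EXTERNAL
  theorems the printed proof quotes, over a vocabulary neither Mathlib nor the tree has … Prop. 6.13 =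
  Ribet–Takahashi 1997 Thm. 2, `j_q ∣ #Φ_q(A)`, Ribet's Eisenstein property";
* the BSD line (`Summits/BirchSwinnertonDyer`, class X11b at a multiplicative prime, route
  `ErratumRoadFive` crux `ShimuraDisplays` / `ClassRecordThree` crux `ShimuraDisplaysAtThree`): the
  predicate `Summit.BirchSwinnertonDyer.Rank1Residual.X11b.P2ShimuraDisplaysAt` displays Pasten's
  four §6 identities (P613), (Pij), (P68), (PEis) with abstract functions `δ, cA, ι, κ`.

This file types them ONCE, as cite-tagged named facts (`def … : Prop`, nothing asserted by a
`def`; users take `(h : PastenShimura2024_componentOrders)` etc.), in EXACTLY the hypothesis shapes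
already audited in those proofs files, so that both lines discharge their hypotheses by citation.
The Skolem device is the one of `PastenShimura2024_thm_6_1_b_of_ribetTakahashi_eisenstein_mazurKenku'`:
the printed quantities `i_p(D,M)`, `j_p(D,M)` (Pasten §6.6, orders of the image and of the cokernel
of `q_{D,M,p,*} : Φ_p(J₀^D(M)) → Φ_p(A_{D,M})`) cannot be DEFINED in the tree, so the one named fact
`PastenShimura2024_componentOrders` asserts the existence of functions `cI cJ` of a Shimura-curve
parametrisation datum `P` (which determines the level `(D, M)` through its curve `X` and the optimal
quotient through its isogeny class) and a prime `p`, satisfying the four PRINTED properties, each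
of which is a separate predicate below with its own locator: `ComponentOrders.ProductEq` (§6.4 +
§6.6: `i_p j_p = #Φ_p(A_{D,M}) = c_p(A_{D,M})` at `p ∥ N`), `ComponentOrders.Prop613`
(Prop. 6.13 = [RiTa] Thm. 2), `ComponentOrders.ImageEisenstein` (proof of Lemma 6.14, first
paragraph: Ribet's Eisenstein property), `ComponentOrders.CokernelDvd` (Lemma 6.18 = [PaRa]
Cor. 3.5). The four share `i_p`, `j_p` — Pasten's Lemmas 6.15–6.16 and Thm. 6.17 USE the same
`j_p(D,M)` in two instances of Prop. 6.13 and in `j_p ∣ #Φ_p` at once — which is why they are one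
fact and not four (four independent existentials would not be the printed statement). A second,
independent named fact `PastenShimura2024_lemma_6_8_isogeny` records the functoriality argument of
the proof of Lemma 6.8 (numerator and denominator of `c_p(A)/c_p(B)` divide the degree of ANY
`ℚ`-isogeny `A → B`), over the tree's `WeierstrassCurve.Isogeny`; with Mazur–Kenku (tree fact
`mazurKenku_exists_cyclic_isogeny`) it gives the printed Lemma 6.8 (`h68_of_lemma_6_8_isogeny`),
and with an isogeny of degree prime to `ℓ` it gives `ord_ℓ c_p(A) = ord_ℓ c_p(B)` (the BSD line's
(P68) at a non-Eisenstein prime).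

## Rendering (the tree's idiom, module docstring of `ShimuraCurveRibetTakahashi.lean`)

`E` = a globally minimal `W/ℚ` of conductor `N = W.conductorNorm ℤ`; an admissible factorisation
`N = DM` = `IsAdmissibleFactorization N D M`; `X₀^D(M)` = any `X : ShimuraCurveData D M`;
`δ_{D,M}(E) = P.deg` and `A_{D,M}` = the curve `W'` of a datum `P : ShimuraParametrizationData X W'`
with `P.IsMinimalFor W` (every parametrisation in the Hecke line factors through the optimal
quotient `q_{D,M}`; all clauses below concern levels with a prime of multiplicative reduction, so
`E` is not CM and the curve of a class-minimal analytic datum is a `ℚ`-model of `A_{D,M}`);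
`c_p(A) := v_p(Δ_A)` (§6.4, minimal discriminant) = `(A.minimalDiscriminantNorm ℤ).factorization p`;
"`p` of multiplicative reduction" / "`p` exactly divides" = `p ∣ N ∧ ¬ p² ∣ N`; `a_r(A) =
A.LFunction r` (Mathlib, from local minimal models); `i_p(D,M) = cI P p`, `j_p(D,M) = cJ P p`.

## Contents

* `ComponentOrderFun` — the type of the Skolem functions (a datum and a prime ↦ a natural number).
* `ComponentOrders.ProductEq`, `.Prop613`, `.ImageEisenstein`, `.CokernelDvd` — the four printed
  properties as predicates on `(cI, cJ)` (shapes only; nothing asserted).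
* `PastenShimura2024_componentOrders` — THE named fact: `∃ cI cJ > 0` with the four properties.
* `PastenShimura2024_lemma_6_8_isogeny` — named fact: Lemma 6.8 in functoriality form.
* API (theorems): `ComponentOrders.ProductEq.cokernel_dvd` (⟹ the hypothesis `hJc`: `j_p ∣ c_p(A)`
  for `p ∣ D`, "by definition", proof of Lemma 6.15), `ComponentOrders.Prop613.exists_form` (⟹ the
  `∃ i j` hypothesis `h613` of `eqSequentially_of_prop_6_13_of_lemma_6_8`),
  `h68_of_lemma_6_8_isogeny` (Lemma 6.8 as printed, `≤ 163`, from the functoriality form and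
  Mazur–Kenku), `PastenShimura2024_componentOrders.eqSequentially` ((EqSequentially) of §6.9 from
  the two facts and Mazur–Kenku).
* DISCHARGE (theorem) `PastenShimura2024_lemma_6_8_isogeny_holds`: the functoriality form of
  Lemma 6.8 PROVED, by strong induction on the degree of the isogeny extending the tree's cyclic case
  `exists_ordMinimalDiscriminant_mul_eq_mul_of_isCyclic` (`PastenHeightBoundsLemma68LocalProofs`):
  an isogeny of degree divisible by the prime `ℓ` either kills `E[ℓ]` (then it is `λ ∘ [ℓ]` between
  the same curves) or factors through a `ℚ`-rational quotient of degree `ℓ`, along which `ord_v Δ_min`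
  is multiplied or divided by `ℓ` (`exists_ordMinimalDiscriminant_mul_eq_mul_of_degree_eq`).
* Theorems for the consumers' "isogeny of degree prime to `p`": with `E[p]` irreducible, `p ∣ deg φ`
  forces `E[p] ⊆ ker φ` (`Isogeny_geomTorsion_le_ker_of_irreducible_of_prime_dvd`), so isogenous
  curves are joined by an isogeny of degree prime to `p`
  (`exists_isogeny_not_dvd_degree_of_hasIrreducibleModPGaloisRep` — no Mazur–Kenku needed), and
  Lemma 6.8 then reads `c_q(A) · b = a · c_q(B)` with `a, b` prime to `p`, i.e.
  `ord_p c_q(A) = ord_p c_q(B)` (`exists_factorization_minimalDiscriminantNorm_mul_eq_mul_not_dvd`,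
  `padicValNat_factorization_minimalDiscriminantNorm_eq_of_hasIrreducibleModPGaloisRep`); and
  `p ∥ N ⇒` multiplicative at `v_p` (`hasMultiplicativeReductionAt_primesEquiv_symm_of_dvd_of_not_sq_dvd`).
  In the reverse direction (`λ : A_{D,M} → E` of the Heegner-point display): the dual of an
  isogeny of degree `n` has degree `n` (`Isogeny_degree_eq_of_comp_eq_degree_zsmul`, over the
  tree's theorem `Isogeny.exists_dual_of_isElliptic`), whence an isogeny `W' → W` of degree prime
  to `p` from `W[p]` irreducible (`exists_isogeny_symm_not_dvd_degree_of_hasIrreducibleModPGaloisRep`).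

Not here: Lemma 6.7 (Chebotarev with Mazur/Faltings, hypothesis `h67` of the `abc` files), Lemmas
6.9–6.12 (Diophantine), Lemmas 6.15–6.16 / Thm. 6.17 (Pasten's own deductions, PERFORMED in
`ShimuraCurveRibetTakahashiCokernelProofs.lean` from the shapes typed here); Néron models.

## References

* [PastenShimura2024] H. Pasten, J. Number Theory 254 (2024) 214–335 = arXiv:1705.09251, §6.4,
  Lemma 6.8 (p0022), §6.6, Prop. 6.13, Lemma 6.14 (p0023), Lemma 6.18 (p0024), §6.9 (p0025). READ.
* [RibetTakahashi1997] K. A. Ribet, S. Takahashi, PNAS 94 (1997) 11110–11114 — READ in the primary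
  (open full text PMC34176, 2026-08-26; the displayed formulas are images there, the prose is
  verbatim): for a SEMISTABLE class (`N` squarefree) and `N = D·p·q·M`, `J = J₀^D(pqM) → A` and
  `J′ = J₀^{Dpq}(M) → A′` the optimal quotients in the class, `c_p = ord_p Δ(A)` ("the order of
  the group of components of the fiber at p of the Néron model for A. This group is cyclic"),
  Thm. 1: "One has [display — an image in the PMC text; it reads `δ_D(pqM)·ℰ(D,p,q,M)² =
  δ_{Dpq}(M)·c′_p·c_q`, as the proof's Props. 1–2 below and Pasten Prop. 6.13 both give] where the
  'error term' `ℰ(D,p,q,M)` is a positive divisor of `c′_p c_q`. Further, suppose that `M` is square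
  free but not a prime
  number, and let `ℓ` be a prime number which divides `ℰ(D,p,q,M)`. Then the Gal(ℚ̄/ℚ)-module `A[ℓ]`
  is reducible"; Thm. 2 (§"The First Assertion of Theorem 1"): "`ℰ(D,p,q,M) = #image ξ_* · #coker ξ′_*`"
  for `ξ_* : Φ(J,q) → Φ(A,q)` (`q` in the Eichler level of `J`) and `ξ′_* : Φ(J′,p) → Φ(A′,p)` (`p` in
  the discriminant of `J′`), proved from Props. 1–2 (`δ·c_q = (ℒ:𝒳(A,q))²·τ`, `δ′·c′_p =
  (ℒ:𝒳(A′,p))²·τ`, `(ℒ:𝒳) = #coker`) — so Pasten's `i_p(d,prM)`, `j_r(dpr,M)` of Prop. 6.13 are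
  RT's `#image ξ_*`, `#coker ξ′_*` with (Pasten `p, r`) = (RT `q, p`), exactly the shape of
  `ComponentOrders.Prop613` below (`cI` at an Eichler-level prime of the larger level, `cJ` at a
  discriminant prime of the smaller level); Prop. 3 (§"The Second Assertion of Theorem 1", `N`
  squarefree, `A[ℓ]` irreducible): the `ℓ`-part of `ℰ` is `#coker(ξ′_*)[ℓ^∞]` because "Φ(J,q) is
  Eisenstein in the sense that `T_r` acts on Φ(J,q) as `1 + r`" (Ribet for `D = 1`; Buzzard,
  Jordan–Livné for `D > 1`) — the argument Pasten's Lemma 6.14 follows; §1 (paragraph before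
  Thm. 1): "`ord_ℓ c_p = ord_ℓ c′_p` … for each prime `ℓ` such that `A[ℓ]` is irreducible. Indeed …
  any rational isogeny `A → A′` of degree divisible by `ℓ` factors through the multiplication-by-`ℓ`
  map on `A`. Hence there is an isogeny `ϕ : A → A′` whose degree is prime to `ℓ`" — the printed
  source of `exists_isogeny_not_dvd_degree_of_hasIrreducibleModPGaloisRep` and
  `padicValNat_factorization_minimalDiscriminantNorm_eq_of_hasIrreducibleModPGaloisRep` below. Pasten
  Prop. 6.13 ("Except for the notation, this is Theorem 2 in [RiTa] … the proof in loc. cit. does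
  not need `M` to be squarefree") is the refereed statement at a general admissible level, which is
  what this file types. Restated in Takahashi, JNT 90 (2001) pp. 75–76 (held, read). [Takahashi2001]
* [PapikianRabinoff2016] M. Papikian, J. Rabinoff, Canad. J. Math. 68 (2016) 1362–1381, Cor. 3.5
  (cited through Pasten Lemma 6.18).
* K. Ribet, Sém. Théor. Nombres Bordeaux 1987–88, exp. 6 (Pasten's [RibetEisenstein], cited through
  the proof of Lemma 6.14). [Mazur1978] Thm. 1, [Kenku1982] (Lemma 6.8's `n ≤ 163`).
* [SilvermanAEC2009] J. H. Silverman, *The Arithmetic of Elliptic Curves*, 2nd ed., Cor. III.4.11,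
  Prop. III.4.12, Rem. III.4.13.2, Cor. III.5.4, Cor. III.6.4(b), Prop. VII.5.1(b) (the isogeny
  factorisations and `#E[ℓ] = ℓ²` used in the proof of `PastenShimura2024_lemma_6_8_isogeny_holds`).
* [GreenbergLNM1716] R. Greenberg, *Iwasawa theory for elliptic curves*, LNM 1716 (1999) 51–144, §5
  (PDF p0137 of the held volume): "E[p] is reducible as a G_ℚ-module, i.e., E admits a cyclic
  ℚ-isogeny of degree p". READ at the page.
* [SilvermanATAEC1994] J. H. Silverman, *Advanced Topics*, Thm. IV.10.2(b) (`f_v = 1 ↔`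
  multiplicative reduction; tree `conductorExponent_eq_one_iff_holds`).
-/

noncomputable section

open scoped MatrixGroups ModularForm

namespace Literature.NumberTheory.Automorphic

open Literature.NumberTheory.EllipticCurves (mazurKenku_exists_cyclic_isogeny le_of_mem_kenkuDegrees)

/-! ### The Skolem functions -/

/-- The type of a function `(P, p) ↦ n ∈ ℕ` on Shimura-curve parametrisation data (of any level
`(D, M)`, of any curve) and natural numbers: the shape in which the printed quantities `i_p(D,M)`,
`j_p(D,M)` of Pasten §6.6 (orders of the image and cokernel of `q_{D,M,p,*}` on Néron component
groups — not constructible in the tree) are quantified, as in the hypotheses `cI cJ` of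
`PastenShimura2024_thm_6_1_b_of_ribetTakahashi_eisenstein_mazurKenku'`. The datum `P` determines
the level through `X` and the optimal quotient `A_{D,M}` through the isogeny class of its curve.
[cite: PastenShimura2024, §6.6 (p0023), definition of i_p(D,M), j_p(D,M)] -/
abbrev ComponentOrderFun : Type 1 :=
  ∀ {D M : ℕ} {X : ShimuraCurveData D M} {W' : WeierstrassCurve ℚ}, ShimuraParametrizationData X W' → ℕ → ℕ

namespace ComponentOrders

/-! ### The four printed properties of `i_p(D,M)`, `j_p(D,M)` (predicates; nothing asserted) -/

/-- **§6.4 + §6.6: `i_p(D,M) · j_p(D,M) = #Φ_p(A_{D,M}) = c_p(A_{D,M})` at a multiplicative prime.**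
Printed: §6.6 (p0023) "the map `q_{D,M} : J₀^D(M) → A_{D,M}` induces the map
`q_{D,M,p,*} : Φ_p(J₀^D(M)) → Φ_p(A_{D,M})` on the groups of geometric components …
`i_p(D,M) = # image(q_{D,M,p,*})`, `j_p(D,M) = # cokernel(q_{D,M,p,*})`" — so `i_p j_p = #Φ_p(A_{D,M})`
(a subgroup of a finite abelian group and the quotient by it) — and §6.4 (p0022) "Suppose now that
`A` is an elliptic curve over `ℚ` with multiplicative reduction at `p`. Then `Φ_p(A)` is a cyclic
group of order `c_p(A) := v_p(Δ_A)`" (also proof of Lemma 6.15, p0024: "by definition `j_p(D,M)`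
divides `c_p(A_{D,M}) = #Φ_p(A_{D,M})`"). `A_{D,M}` is isogenous to `E` (§6.1), so it has
multiplicative reduction exactly at the primes `p ∥ N`. Rendering (module docstring): for every
admissible `N = DM` of the conductor of `E` (globally minimal `W`), every class-minimal datum `P` on
an `X : ShimuraCurveData D M` with curve `W'` (= `A_{D,M}`) and every prime `p ∣ N`, `p² ∤ N`:
`cI P p * cJ P p = v_p(Δ_min(W'))`. A predicate on `(cI, cJ)`; nothing asserted.
[cite: PastenShimura2024, §6.6 (p0023) and §6.4 (p0022) (shape only; nothing asserted)] -/
def ProductEq (cI cJ : ComponentOrderFun) : Prop :=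
  ∀ {N D M : ℕ}, IsAdmissibleFactorization N D M →
    ∀ (X : ShimuraCurveData D M) (W : WeierstrassCurve ℚ) [W.IsElliptic] [W.IsGloballyMinimal],
      W.conductorNorm ℤ = N →
    ∀ (W' : WeierstrassCurve ℚ) [W'.IsElliptic] (P : ShimuraParametrizationData X W'),
      P.IsMinimalFor W → ∀ p : ℕ, p.Prime → p ∣ N → ¬ p ^ 2 ∣ N →
        cI P p * cJ P p = (W'.minimalDiscriminantNorm ℤ).factorization p

/-- **Pasten 2024, Proposition 6.13 (= Ribet–Takahashi 1997, Thm. 2).** Printed (p0023): "Let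
`N = DM` be an admissible factorization of the conductor of `E`, and suppose that `p, r` are two
distinct primes dividing `D`. Let us write `D = dpr`. Then
`δ_{d,prM}/δ_{dpr,M} = c_p(A_{d,prM}) · c_r(A_{dpr,M}) / (i_p(d,prM)² · j_r(dpr,M)²)
= c_r(A_{d,prM}) · c_p(A_{dpr,M}) / (i_r(d,prM)² · j_p(dpr,M)²)`. Proof. Except for the notation,
this is Theorem 2 in [RiTa] — symmetry on `p` and `r` follows from the fact that
`δ_{d,prM}/δ_{dpr,M}` is symmetric on `p` and `r`. At this point one must note that the proof in
loc. cit. does not need `M` to be squarefree". Rendering (module docstring; the shape is VERBATIM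
the hypothesis `h613` of `PastenShimura2024_thm_6_1_b_of_ribetTakahashi_eisenstein_mazurKenku'`): for
`N = DM` admissible, `D = d·(p·r)` with `p ≠ r` primes, `M₁ = prM`, data `P₁` realising `δ_{d,prM}`
(class-minimal on an `X₁ : ShimuraCurveData d M₁`, curve `W₁' = A_{d,prM}`) and `P₂` realising
`δ_{D,M}` (on `X₂ : ShimuraCurveData D M`, curve `W₂' = A_{D,M}`):
`δ_{d,prM} · i_p(d,prM)² · j_r(D,M)² = δ_{D,M} · c_p(A_{d,prM}) · c_r(A_{D,M})`, i.e.
`P₁.deg * (cI P₁ p ^ 2 * cJ P₂ r ^ 2) = P₂.deg * (v_p(Δ(W₁')) * v_r(Δ(W₂')))`; the second printed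
form is the same statement with `p, r` exchanged (`D = d·(r·p)`). A predicate; nothing asserted.
[cite: PastenShimura2024, Prop. 6.13 (p0023) (shape only; nothing asserted)]
[cite: RibetTakahashi1997, Thm. 1 (first assertion) and Thm. 2, §"The First Assertion of Theorem 1" (semistable case; = Pasten Prop. 6.13 with (p, r) ↦ (q, p)) (shape only; nothing asserted)] -/
def Prop613 (cI cJ : ComponentOrderFun) : Prop :=
  ∀ {N d M₁ D M p r : ℕ}, p.Prime → r.Prime → p ≠ r → D = d * (p * r) → M₁ = p * r * M →
    IsAdmissibleFactorization N D M →
    ∀ (X₁ : ShimuraCurveData d M₁) (X₂ : ShimuraCurveData D M)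
      (W : WeierstrassCurve ℚ) [W.IsElliptic] [W.IsGloballyMinimal], W.conductorNorm ℤ = N →
    ∀ (W₁' : WeierstrassCurve ℚ) [W₁'.IsElliptic] (P₁ : ShimuraParametrizationData X₁ W₁'),
      P₁.IsMinimalFor W →
    ∀ (W₂' : WeierstrassCurve ℚ) [W₂'.IsElliptic] (P₂ : ShimuraParametrizationData X₂ W₂'),
      P₂.IsMinimalFor W →
      P₁.deg * (cI P₁ p ^ 2 * cJ P₂ r ^ 2) =
        P₂.deg * ((W₁'.minimalDiscriminantNorm ℤ).factorization p *
          (W₂'.minimalDiscriminantNorm ℤ).factorization r)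

/-- **Ribet's Eisenstein property of `Φ_p(J₀^D(M))` at `p ∥ M` (Pasten 2024, proof of Lemma 6.14).**
Printed (p0023, proof of Lemma 6.14, whose hypothesis is "`p` exactly divides `M`"): "We follow the
idea of the proof of Proposition 3 in [RiTa]. The group `Φ_p(J₀^D(M))` is Eisenstein in the sense
that for `r ∤ N`, the Hecke operator `T_r` acts on it as multiplication by `r+1`
(cf. [RibetEisenstein]). On the other hand, since `A_{D,M}` is the optimal quotient associated to
`χ_{D,M}`, the action of `T_r` on `J₀^D(M)` induces multiplication by `χ_{D,M}(T_r) = a_r(A_{D,M})` on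
`A_{D,M}`. Hence, `r+1−a_r(A_{D,M})` acts as `0` on `im(ξ_{p,*})`, which is a cyclic group of order
`i_p(J₀^D(M),χ_{D,M})` because it is a subgroup of the cyclic group `Φ_p(A_{D,M})`. It follows that
`i_p(J₀^D(M),χ_{D,M})` divides `r+1−a_r(A_{D,M})` for every prime `r ∤ N`." Rendering (module
docstring; VERBATIM the hypothesis `hEis` of
`PastenShimura2024_thm_6_1_b_of_ribetTakahashi_eisenstein_mazurKenku'`): for `N = DM` admissible, a
class-minimal datum `P` with curve `W' = A_{D,M}`, a prime `p` with `p ∣ M`, `p² ∤ M`, and every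
prime `r ∤ N`: `(cI P p : ℤ) ∣ r + 1 − a_r(W')`. (`a_r(A_{D,M}) = a_r(E)`, the curves being
isogenous — tree `WeierstrassCurve.IsIsogenous.LFunction_eq`.) A predicate; nothing asserted.
[cite: PastenShimura2024, Lemma 6.14 (proof, first paragraph, p0023) (shape only; nothing asserted)] -/
def ImageEisenstein (cI : ComponentOrderFun) : Prop :=
  ∀ {N D M : ℕ}, IsAdmissibleFactorization N D M →
    ∀ (X : ShimuraCurveData D M) (W : WeierstrassCurve ℚ) [W.IsElliptic] [W.IsGloballyMinimal],
      W.conductorNorm ℤ = N →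
    ∀ (W' : WeierstrassCurve ℚ) [W'.IsElliptic] (P : ShimuraParametrizationData X W'),
      P.IsMinimalFor W → ∀ p : ℕ, p.Prime → p ∣ M → ¬ p ^ 2 ∣ M →
      ∀ r : ℕ, r.Prime → ¬ r ∣ N → (cI P p : ℤ) ∣ (r + 1 : ℤ) - W'.LFunction r

/-- **Pasten 2024, Lemma 6.18 (Papikian–Rabinoff): the cokernel at a prime of `D` divides
`p − 1`.** Printed (p0024): "Let `E` be an elliptic curve over `ℚ` of conductor `N` and consider an
admissible factorization `N = DM`. Let `p` be a prime with `p ∣ D`. Then `j_p(D,M)` divides `p − 1`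
if `p` is odd, and it divides `2` if `p = 2`. In particular, `j_p(D,M) ≤ p`. Proof. … we reduce to
the split toric reduction case, and then the result follows from Corollary 3.5 in [PaRa]."
Rendering (module docstring): for `N = DM` admissible, a class-minimal datum `P` (curve `A_{D,M}`)
and a prime `p ∣ D`: `p ≠ 2 → cJ P p ∣ p − 1` and `p = 2 → cJ P p ∣ 2`. A predicate; nothing
asserted. [cite: PastenShimura2024, Lemma 6.18 (p0024) (shape only; nothing asserted)]
[cite: PapikianRabinoff2016, Cor. 3.5 (through Pasten Lemma 6.18) (shape only; nothing asserted)] -/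
def CokernelDvd (cJ : ComponentOrderFun) : Prop :=
  ∀ {N D M : ℕ}, IsAdmissibleFactorization N D M →
    ∀ (X : ShimuraCurveData D M) (W : WeierstrassCurve ℚ) [W.IsElliptic] [W.IsGloballyMinimal],
      W.conductorNorm ℤ = N →
    ∀ (W' : WeierstrassCurve ℚ) [W'.IsElliptic] (P : ShimuraParametrizationData X W'),
      P.IsMinimalFor W → ∀ p : ℕ, p.Prime → p ∣ D →
        (p ≠ 2 → cJ P p ∣ p - 1) ∧ (p = 2 → cJ P p ∣ 2)

end ComponentOrders

/-! ### The named facts -/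

/-- **Pasten 2024, §6.6 with §6.4, Prop. 6.13, Lemma 6.14 (proof) and Lemma 6.18: the image and
cokernel orders of the optimal quotient on Néron component groups and their printed properties.**
For every elliptic curve `E/ℚ` of conductor `N`, every admissible `N = DM` and every prime `p`, the
map `q_{D,M,p,*} : Φ_p(J₀^D(M)) → Φ_p(A_{D,M})` induced by the optimal quotient
`q_{D,M} : J₀^D(M) → A_{D,M}` (Jacquet–Langlands; `A_{D,M}` isogenous to `E`, §6.1 p0020) on the
groups of geometric connected components of the special fibres at `p` of the Néron models (§6.4
p0022) has an image of order `i_p(D,M)` and a cokernel of order `j_p(D,M)` (§6.6 p0023), and these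
positive integers satisfy: (Π) `i_p(D,M) j_p(D,M) = #Φ_p(A_{D,M}) = c_p(A_{D,M}) = v_p(Δ_{A_{D,M}})` for
`p ∥ N` (§6.4: "`Φ_p(A)` is a cyclic group of order `c_p(A) := v_p(Δ_A)`" at a multiplicative
prime); (6.13) for `p ≠ r` primes dividing `D = dpr`,
`δ_{d,prM}/δ_{dpr,M} = c_p(A_{d,prM}) c_r(A_{dpr,M}) / (i_p(d,prM)² j_r(dpr,M)²)` (Prop. 6.13 =
Ribet–Takahashi 1997 Thm. 2, `M` arbitrary); (6.14) for `p ∥ M` and every prime `r ∤ N`,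
`i_p(D,M) ∣ r + 1 − a_r(A_{D,M})` (Ribet's Eisenstein property of `Φ_p(J₀^D(M))`, proof of
Lemma 6.14); (6.18) for `p ∣ D`, `j_p(D,M) ∣ p − 1` (`p` odd), `j_2(D,M) ∣ 2` (Lemma 6.18, from
Papikian–Rabinoff Cor. 3.5). Rendering (module docstring): ONE existential over the Skolem
functions `cI cJ : ComponentOrderFun` (`i_p(D,M) = cI P p`, `j_p(D,M) = cJ P p` at a class-minimal
datum `P` of level `(D, M)`), positive everywhere, with the four predicates
`ComponentOrders.ProductEq`, `.Prop613`, `.ImageEisenstein`, `.CokernelDvd` — verbatim the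
hypotheses `cI cJ hI hJ h613 hEis` (and, via `ComponentOrders.ProductEq.cokernel_dvd`, `hJc`) of
`PastenShimura2024_thm_6_1_b_of_ribetTakahashi_eisenstein_mazurKenku'`, and (via
`ComponentOrders.Prop613.exists_form`) the hypothesis `h613` of
`eqSequentially_of_prop_6_13_of_lemma_6_8`; on the BSD side they are the displays (P613), (Pij),
(PEis) of `Summit.BirchSwinnertonDyer.Rank1Residual.X11b.P2ShimuraDisplaysAt`. One fact and not
four because the printed statements share the quantities `i_p`, `j_p` (Lemmas 6.15–6.16 use one
`j_p(D,M)` in two instances of Prop. 6.13 and in (Π) simultaneously). PUBLISHED (refereed) results,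
stated through the refereed secondary source that assembles them; not provable in the tree (no
Néron models / component groups; Čerednik–Drinfeld and Deligne–Rapoport uniformisations, Ribet's
exact sequence and Grothendieck's monodromy pairing behind Prop. 6.13; [RibetEisenstein]; [PaRa]).
Users take `(h : PastenShimura2024_componentOrders)`.
[cite: PastenShimura2024, §6.6 and Prop. 6.13 (p0023), §6.4 (p0022), Lemma 6.14 proof (p0023), Lemma 6.18 (p0024)]
[cite: RibetTakahashi1997, Thms. 1–2 (= Pasten Prop. 6.13, semistable case) and Prop. 3 (Eisenstein property of Φ(J,q))] [cite: PapikianRabinoff2016, Cor. 3.5 (= Pasten Lemma 6.18)] -/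
def PastenShimura2024_componentOrders : Prop :=
  ∃ cI cJ : ComponentOrderFun,
    (∀ {D M : ℕ} {X : ShimuraCurveData D M} {W' : WeierstrassCurve ℚ}
        (P : ShimuraParametrizationData X W') (p : ℕ), 0 < cI P p ∧ 0 < cJ P p) ∧
    ComponentOrders.ProductEq cI cJ ∧ ComponentOrders.Prop613 cI cJ ∧
    ComponentOrders.ImageEisenstein cI ∧ ComponentOrders.CokernelDvd cJ

/-- **Pasten 2024, Lemma 6.8 — the functoriality of `Φ_p` in its proof: numerator and denominator of
`c_p(A)/c_p(B)` divide the degree of any `ℚ`-isogeny `A → B`.** Printed (p0022): "Lemma 6.8. Let `A`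
and `B` be elliptic curves which are isogenous over `ℚ` and suppose that `p` is a prime of
multiplicative reduction for one (hence both) of them. Then `c_p(A)/c_p(B)` is a rational number
whose multiplicative height is at most `163`. … Proof. Let `α : A → B` be an isogeny of minimal
degree; by results of Mazur [MazurRatIsog] and Kenku [Kenku] we know that `n := deg(α) ≤ 163`. Let
`β : B → A` be the dual isogeny, so that `βα = [n]` on `A`. Since `A` and `B` have multiplicative
reduction at `p`, we have isomorphisms of abstract groups `Φ_p(A) = ℤ/c_p(A)ℤ` and
`Φ_p(B) = ℤ/c_p(B)ℤ` [§6.4: "the rule `A ↦ Φ_p(A)` is functorial … `[n]_{p,*}` is multiplication by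
`n` on `Φ_p(A)`"] … From this we get that `c_p(A)/(n, c_p(A)) = # im(n·)` divides `# im(β_{p,*})`,
which divides `c_p(B)`. Thus, the numerator of `c_p(A)/c_p(B)` divides `n`, and similarly for the
denominator using `αβ` instead." The minimality of `α` enters only through `n ≤ 163`; the argument
is printed for the degree `n` of the chosen isogeny and its dual. Recorded in that form (module
docstring): for elliptic `A, B /ℚ`, ANY `ℚ`-isogeny `α : A → B` (tree `WeierstrassCurve.Isogeny`,
`α.degree = #ker α`, characteristic `0`) and a prime `p ∥ N_A` (multiplicative reduction):
`c_p(A) · b = a · c_p(B)` for some `a, b ≥ 1` dividing `α.degree` (numerator and denominator of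
`c_p(A)/c_p(B)` in lowest terms divide `a, b`, hence `n`). The printed Lemma 6.8 is this with
Mazur–Kenku (`h68_of_lemma_6_8_isogeny`, tree fact `mazurKenku_exists_cyclic_isogeny`); the
abstract-group step is the tree's theorem `exists_mul_eq_mul_of_comp_eq_nsmul`
(`ShimuraCurveRibetTakahashiNumeratorProofs.lean`); what is not in the tree is the functor `Φ_p`
(Néron models), the dual isogeny with `βα = [n]`, and `#Φ_p(A) = v_p(Δ_A)` (Kodaira–Néron). Users
take `(h : PastenShimura2024_lemma_6_8_isogeny)`.
[cite: PastenShimura2024, Lemma 6.8 and its proof (p0022), with §6.4 (p0022)] -/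
def PastenShimura2024_lemma_6_8_isogeny : Prop :=
  ∀ (A B : WeierstrassCurve ℚ) [A.IsElliptic] [B.IsElliptic] (α : WeierstrassCurve.Isogeny A B)
    (p : ℕ), p.Prime → p ∣ A.conductorNorm ℤ → ¬ p ^ 2 ∣ A.conductorNorm ℤ →
    ∃ a b : ℕ, 0 < a ∧ 0 < b ∧ a ∣ α.degree ∧ b ∣ α.degree ∧
      (A.minimalDiscriminantNorm ℤ).factorization p * b =
        a * (B.minimalDiscriminantNorm ℤ).factorization p

/-! ### API: the facts deliver the hypotheses of the `abc` proofs files -/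

namespace ComponentOrders

/-- **`j_p(D,M) ∣ #Φ_p(A_{D,M}) = c_p(A_{D,M})` for `p ∣ D`** ("by definition", proof of Lemma 6.15,
p0024) — the hypothesis `hJc` of `PastenShimura2024_thm_6_1_b_of_ribetTakahashi_eisenstein_mazurKenku'`,
from (Π): a prime of `D` divides `N` exactly once (`IsAdmissibleFactorization.dvd_and_not_sq_dvd`),
and `j ∣ i·j`. [cite: PastenShimura2024, Lemma 6.15 (proof, first sentence, p0024)] -/
theorem ProductEq.cokernel_dvd {cI cJ : ComponentOrderFun} (h : ProductEq cI cJ)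
    {N D M : ℕ} (hadm : IsAdmissibleFactorization N D M)
    (X : ShimuraCurveData D M) (W : WeierstrassCurve ℚ) [W.IsElliptic] [W.IsGloballyMinimal]
    (hWN : W.conductorNorm ℤ = N)
    (W' : WeierstrassCurve ℚ) [W'.IsElliptic] (P : ShimuraParametrizationData X W')
    (hP : P.IsMinimalFor W) (p : ℕ) (hp : p.Prime) (hpD : p ∣ D) :
    cJ P p ∣ (W'.minimalDiscriminantNorm ℤ).factorization p := by
  obtain ⟨hpN, hp2N⟩ := hadm.dvd_and_not_sq_dvd hp hpD
  exact Dvd.intro_left _ (h hadm X W hWN W' P hP p hp hpN hp2N)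

/-- **`i_p(D,M) ∣ c_p(A_{D,M})` for `p ∥ N`**, the other half of (Π). [cite: PastenShimura2024, §6.6 (p0023)] -/
theorem ProductEq.image_dvd {cI cJ : ComponentOrderFun} (h : ProductEq cI cJ)
    {N D M : ℕ} (hadm : IsAdmissibleFactorization N D M)
    (X : ShimuraCurveData D M) (W : WeierstrassCurve ℚ) [W.IsElliptic] [W.IsGloballyMinimal]
    (hWN : W.conductorNorm ℤ = N)
    (W' : WeierstrassCurve ℚ) [W'.IsElliptic] (P : ShimuraParametrizationData X W')
    (hP : P.IsMinimalFor W) (p : ℕ) (hp : p.Prime) (hpN : p ∣ N) (hp2N : ¬ p ^ 2 ∣ N) :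
    cI P p ∣ (W'.minimalDiscriminantNorm ℤ).factorization p :=
  Dvd.intro _ (h hadm X W hWN W' P hP p hp hpN hp2N)

/-- **Prop. 6.13 in the form `∃ i j > 0`** — the hypothesis `h613` of
`eqSequentially_of_prop_6_13_of_lemma_6_8` and of `PastenShimura2024_thm_6_1_of_prop_6_13_of_mazurKenku'`
(`ShimuraCurveRibetTakahashiNumeratorProofs.lean`, `…PairwiseDenominatorProofs.lean`), by
instantiating the Skolem functions. [cite: PastenShimura2024, Prop. 6.13 (p0023)] -/
theorem Prop613.exists_form {cI cJ : ComponentOrderFun} (h : Prop613 cI cJ)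
    (hpos : ∀ {D M : ℕ} {X : ShimuraCurveData D M} {W' : WeierstrassCurve ℚ}
      (P : ShimuraParametrizationData X W') (p : ℕ), 0 < cI P p ∧ 0 < cJ P p)
    {N D M d p r : ℕ} (hp : p.Prime) (hr : r.Prime) (hpr : p ≠ r) (hD : D = d * (p * r))
    (hadm : IsAdmissibleFactorization N D M)
    (X₁ : ShimuraCurveData d (p * r * M)) (X₂ : ShimuraCurveData D M)
    (W : WeierstrassCurve ℚ) [W.IsElliptic] [W.IsGloballyMinimal] (hWN : W.conductorNorm ℤ = N)
    (W₁' : WeierstrassCurve ℚ) [W₁'.IsElliptic] (P₁ : ShimuraParametrizationData X₁ W₁')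
    (hP₁ : P₁.IsMinimalFor W)
    (W₂' : WeierstrassCurve ℚ) [W₂'.IsElliptic] (P₂ : ShimuraParametrizationData X₂ W₂')
    (hP₂ : P₂.IsMinimalFor W) :
    ∃ i j : ℕ, 0 < i ∧ 0 < j ∧
      P₁.deg * (i ^ 2 * j ^ 2) = P₂.deg *
        ((W₁'.minimalDiscriminantNorm ℤ).factorization p *
          (W₂'.minimalDiscriminantNorm ℤ).factorization r) :=
  ⟨cI P₁ p, cJ P₂ r, (hpos P₁ p).1, (hpos P₂ r).2,
    h hp hr hpr hD rfl hadm X₁ X₂ W hWN W₁' P₁ hP₁ W₂' P₂ hP₂⟩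

end ComponentOrders

/-- **Lemma 6.8 as printed (height `≤ 163`) from its functoriality form and Mazur–Kenku** — the
hypothesis `h68` of `eqSequentially_of_prop_6_13_of_lemma_6_8`: for `ℚ`-isogenous elliptic `W, W'`
and `p ∥ N_W`, `c_p(W') · b = a · c_p(W)` with `1 ≤ a, b ≤ 163`. Proof (as printed): take the
`ℚ`-isogeny `α : W → W'` of Mazur–Kenku (`mazurKenku_exists_cyclic_isogeny`, degree in
`kenkuDegrees`, so `≤ 163`), apply `PastenShimura2024_lemma_6_8_isogeny` to it and exchange the
roles of `a, b`. [cite: PastenShimura2024, Lemma 6.8 (p0022)] [cite: Mazur1978, Thm. 1] [cite: Kenku1982] -/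
theorem h68_of_lemma_6_8_isogeny (h : PastenShimura2024_lemma_6_8_isogeny)
    (hMK : mazurKenku_exists_cyclic_isogeny)
    (W W' : WeierstrassCurve ℚ) [W.IsElliptic] [W'.IsElliptic] (hiso : W.IsIsogenous W')
    (p : ℕ) (hp : p.Prime) (hpN : p ∣ W.conductorNorm ℤ) (hp2N : ¬ p ^ 2 ∣ W.conductorNorm ℤ) :
    ∃ a b : ℕ, 0 < a ∧ a ≤ 163 ∧ 0 < b ∧ b ≤ 163 ∧
      (W'.minimalDiscriminantNorm ℤ).factorization p * b =
        a * (W.minimalDiscriminantNorm ℤ).factorization p := by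
  obtain ⟨α, -, hdeg⟩ := hMK W W' hiso
  have hn : α.degree ≤ 163 := le_of_mem_kenkuDegrees hdeg
  have hnpos : 0 < α.degree := α.degree_pos
  obtain ⟨a, b, ha, hb, han, hbn, hab⟩ := h W W' α p hp hpN hp2N
  refine ⟨b, a, hb, (Nat.le_of_dvd hnpos hbn).trans hn, ha, (Nat.le_of_dvd hnpos han).trans hn, ?_⟩
  rw [mul_comm, ← hab, mul_comm]

/-- **(EqSequentially) of §6.9 from the two named facts and Mazur–Kenku** (p0025: "By Proposition
6.13 and Lemma 6.8 we have `δ_{d,prm}/δ_{dpr,m} = u_{d,p,r,m}/(i_p(d,prm)² j_r(dpr,m)²) · c_p(E)c_r(E)`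
where `u_{d,p,r,m}` is certain rational number supported on primes `≤ 163`"): the tree's
`eqSequentially_of_prop_6_13_of_lemma_6_8` with its two hypotheses supplied by
`PastenShimura2024_componentOrders` (`ComponentOrders.Prop613.exists_form`) and
`PastenShimura2024_lemma_6_8_isogeny` (`h68_of_lemma_6_8_isogeny`). CONDITIONAL on the three named
facts; the remaining inputs of `PastenShimura2024_thm_6_1` are then the `D = 1` bridge (a theorem,
`ShimuraParametrizationData.modularDegree_dvd_deg`) and the Jacquet–Langlands existence fact
`nonempty_shimuraParametrizationData` (`PastenShimura2024_thm_6_1_of_prop_6_13_of_mazurKenku'`).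
[cite: PastenShimura2024, §6.9 (EqSequentially) (p0025), Prop. 6.13 (p0023), Lemma 6.8 (p0022)] -/
theorem PastenShimura2024_componentOrders.eqSequentially (h : PastenShimura2024_componentOrders)
    (h68 : PastenShimura2024_lemma_6_8_isogeny) (hMK : mazurKenku_exists_cyclic_isogeny)
    {N D M d p r : ℕ} (hp : p.Prime) (hr : r.Prime) (hpr : p ≠ r) (hD : D = d * (p * r))
    (hadm : IsAdmissibleFactorization N D M)
    (X₁ : ShimuraCurveData d (p * r * M)) (X₂ : ShimuraCurveData D M)
    (W : WeierstrassCurve ℚ) [W.IsElliptic] [W.IsGloballyMinimal] (hWN : W.conductorNorm ℤ = N)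
    (W₁' : WeierstrassCurve ℚ) [W₁'.IsElliptic] (P₁ : ShimuraParametrizationData X₁ W₁')
    (hP₁ : P₁.IsMinimalFor W)
    (W₂' : WeierstrassCurve ℚ) [W₂'.IsElliptic] (P₂ : ShimuraParametrizationData X₂ W₂')
    (hP₂ : P₂.IsMinimalFor W) :
    ∃ a b : ℕ, 0 < a ∧ 0 < b ∧ a ≤ 163 ^ 2 ∧ (∀ q ∈ a.primeFactors, q ≤ 163) ∧
      P₁.deg * b = a * P₂.deg *
        ((W.minimalDiscriminantNorm ℤ).factorization p *
          (W.minimalDiscriminantNorm ℤ).factorization r) := by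
  obtain ⟨cI, cJ, hpos, -, h613, -, -⟩ := h
  exact eqSequentially_of_prop_6_13_of_lemma_6_8
    (fun hp hr hpr hD hadm X₁ X₂ W _ _ hWN W₁' _ P₁ hP₁ W₂' _ P₂ hP₂ =>
      ComponentOrders.Prop613.exists_form h613 hpos hp hr hpr hD hadm X₁ X₂ W hWN W₁' P₁ hP₁ W₂' P₂ hP₂)
    (fun W W' _ _ hiso p hp hpN hp2N => h68_of_lemma_6_8_isogeny h68 hMK W W' hiso p hp hpN hp2N)
    hp hr hpr hD hadm X₁ X₂ W hWN W₁' P₁ hP₁ W₂' P₂ hP₂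

/-! ### Discharge of `PastenShimura2024_lemma_6_8_isogeny` (Lemma 6.8, functoriality form) -/

section Lemma68Discharge

open IsDedekindDomain WeierstrassCurve
open Literature.NumberTheory.EllipticCurves (natGenerator_primesEquiv_symm)
open Literature.NumberTheory.EllipticCurves.ModularForms (hasMultiplicativeReductionAt_of_isIsogenous
  ordMinimalDiscriminant_eq_mul_or_of_degree_eq_prime valuation_j_eq_exp_ordMinimalDiscriminant)

/-- **A `ℚ`-isogeny whose degree is divisible by the prime `ℓ` either kills `E[ℓ]` or factors
through a `ℚ`-rational quotient of degree `ℓ`.** For an isogeny `φ : W → W'` of elliptic curves over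
`ℚ` and a prime `ℓ ∣ deg φ`: either `E[ℓ] ⊆ ker φ`, or `φ = λ ∘ ψ` with `ψ : W → W''` an isogeny over
`ℚ` of degree `ℓ` onto an elliptic curve `W''` over `ℚ` and `deg λ · ℓ = deg φ`. Indeed
`H = ker φ ∩ E[ℓ]` is `Γ_ℚ`-stable of order dividing `#E[ℓ] = ℓ²` (Cor. III.6.4(b)) and divisible
by `ℓ` (Cauchy: `ker φ` has an element of order `ℓ`); if `H ≠ E[ℓ]` then `#H = ℓ`, `ψ` is the
quotient by `H` (Prop. III.4.12, Rem. III.4.13.2) and `λ` comes from Cor. III.4.11.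
[cite: SilvermanAEC2009, Cor. III.4.11, Prop. III.4.12 and Rem. III.4.13.2, Cor. III.6.4(b)] -/
theorem Isogeny_geomTorsion_le_ker_or_exists_factor_of_prime_dvd {W W' : WeierstrassCurve ℚ}
    [W.IsElliptic] [W'.IsElliptic] (φ : Isogeny W W') {ℓ : ℕ} (hℓ : ℓ.Prime)
    (hdvd : ℓ ∣ φ.degree) :
    geomTorsion W (ℓ : ℤ) ≤ φ.toAddMonoidHom.ker ∨
      ∃ (W'' : WeierstrassCurve ℚ) (_ : W''.IsElliptic) (ψ : Isogeny W W'') (lam : Isogeny W'' W'),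
        ψ.degree = ℓ ∧ lam.degree * ℓ = φ.degree ∧ ∀ P, φ P = lam (ψ P) := by
  classical
  set G := φ.toAddMonoidHom.ker with hG
  set H := G ⊓ geomTorsion W (ℓ : ℤ) with hH
  by_cases hle : geomTorsion W (ℓ : ℤ) ≤ G
  · exact Or.inl hle
  right
  haveI : Fact ℓ.Prime := ⟨hℓ⟩
  -- `#E[ℓ] = ℓ²`, so `H ≤ E[ℓ]` is finite with `#H ∣ ℓ²`
  have hℓ0 : (ℓ : AlgebraicClosure ℚ) ≠ 0 := by exact_mod_cast hℓ.ne_zero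
  have hcardT : Nat.card (geomTorsion W (ℓ : ℤ)) = ℓ ^ 2 :=
    card_torsionBy_eq_sq (E := W.baseChange (AlgebraicClosure ℚ)) hℓ0
  haveI hTfin : Finite (geomTorsion W (ℓ : ℤ)) := Nat.finite_of_card_ne_zero (by
    rw [hcardT]; exact pow_ne_zero 2 hℓ.ne_zero)
  have hHT : H ≤ geomTorsion W (ℓ : ℤ) := inf_le_right
  have hHG : H ≤ G := inf_le_left
  haveI : Finite H := Finite.of_injective _ (AddSubgroup.inclusion_injective hHT)
  have hdvdT : Nat.card H ∣ ℓ ^ 2 := hcardT ▸ AddSubgroup.card_dvd_of_le hHT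
  -- Cauchy: an element of order `ℓ` in `ker φ`, which lies in `H`; so `ℓ ∣ #H`
  haveI : Finite G := φ.finite_ker
  have hdvdG : ℓ ∣ Nat.card G := hdvd
  obtain ⟨g, hg⟩ := exists_prime_addOrderOf_dvd_card' (G := G) ℓ hdvdG
  have hgo : addOrderOf (g : W.geomPoints) = ℓ := by rw [AddSubgroup.addOrderOf_coe, hg]
  have hgH : (g : W.geomPoints) ∈ H := by
    refine AddSubgroup.mem_inf.mpr ⟨g.2, ?_⟩
    exact AddSubgroup.torsionBy.nsmul_iff.mpr
      (addOrderOf_dvd_iff_nsmul_eq_zero.mp (hgo ▸ dvd_rfl))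
  have hℓH : ℓ ∣ Nat.card H := by
    rw [← hgo, ← Nat.card_zmultiples]
    exact AddSubgroup.card_dvd_of_le (AddSubgroup.zmultiples_le_of_mem hgH)
  -- `#H ≠ ℓ²` (else `H = E[ℓ] ≤ ker φ`), hence `#H = ℓ`
  have hne : Nat.card H ≠ ℓ ^ 2 := by
    intro h
    apply hle
    have hEq : H = geomTorsion W (ℓ : ℤ) :=
      AddSubgroup.eq_of_le_of_card_ge hHT (by rw [h, hcardT])
    rw [← hEq]; exact hHG
  have hcardH : Nat.card H = ℓ := by
    obtain ⟨i, hi, hci⟩ := (Nat.dvd_prime_pow hℓ).mp hdvdT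
    interval_cases i
    · exfalso
      rw [pow_zero] at hci
      rw [hci] at hℓH
      exact hℓ.one_lt.ne' (Nat.dvd_one.mp hℓH)
    · rw [hci, pow_one]
    · exact absurd hci hne
  -- the quotient by `H`
  have hHfin : (H : Set W.geomPoints).Finite :=
    φ.finite_ker.subset fun P hP ↦ (AddSubgroup.mem_inf.mp hP).1
  obtain ⟨W'', hW'', ψ, -, hker, -, -⟩ :=
    W.exists_isogeny_ker_eq_and_comp_eq_nsmul_holds H hHfin
      (fun σ P hP ↦ φ.smul_mem_ker_inf_geomTorsion (ℓ : ℤ) σ hP)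
  haveI := hW''
  have hψdeg : ψ.degree = ℓ := by
    unfold WeierstrassCurve.Isogeny.degree
    rw [hker, hcardH]
  -- factor `φ = λ ∘ ψ`
  have hkerle : ∀ P : W.geomPoints, ψ P = 0 → φ P = 0 := by
    intro P hP
    have hP' : P ∈ ψ.toAddMonoidHom.ker := hP
    rw [hker] at hP'
    exact (AddSubgroup.mem_inf.mp hP').1
  have hdegle : ψ.deg ≤ Nat.card ψ.toAddMonoidHom.ker := by
    rw [← WeierstrassCurve.Isogeny.degree_eq_deg]; exact le_rfl
  obtain ⟨lam, hlam⟩ := ψ.exists_eq_comp_of_ker_le φ hdegle hkerle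
  have hcomp : φ.toAddMonoidHom = lam.toAddMonoidHom.comp ψ.toAddMonoidHom := by
    ext P; exact hlam P
  have hcard : φ.degree = lam.degree * ψ.degree := by
    unfold WeierstrassCurve.Isogeny.degree
    rw [hcomp]
    exact AddMonoidHom.natCard_ker_comp_of_surjective _ _ ψ.surjective
  exact ⟨W'', hW'', ψ, lam, hψdeg, by rw [hcard, hψdeg], hlam⟩

/-- **An isogeny killing `E[ℓ]` is `λ ∘ [ℓ]` with `deg λ · ℓ² = deg φ`.** For an isogeny
`φ : W → W'` of elliptic curves over `ℚ` with `E[ℓ] ⊆ ker φ`, `ℓ ≥ 1`: `φ = λ ∘ [ℓ]` for an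
isogeny `λ : W → W'` over `ℚ` (Cor. III.4.11 with Cor. III.5.4, the tree's
`Isogeny.exists_eq_comp_nsmul_of_geomTorsion_le_ker_holds'`), and `deg φ = deg λ · #E[ℓ] = deg λ · ℓ²`
since `[ℓ]` maps `E(ℚ̄)` onto itself (Thm. II.2.3 / §VIII.2) with kernel `E[ℓ]` of order `ℓ²`
(Cor. III.6.4(b)). [cite: SilvermanAEC2009, Cor. III.4.11 with Cor. III.5.4, Cor. III.6.4(b)] -/
theorem Isogeny_exists_eq_comp_nsmul_degree_of_geomTorsion_le_ker {W W' : WeierstrassCurve ℚ}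
    [W.IsElliptic] [W'.IsElliptic] (φ : Isogeny W W') {ℓ : ℕ} (hℓ : ℓ ≠ 0)
    (hle : geomTorsion W (ℓ : ℤ) ≤ φ.toAddMonoidHom.ker) :
    ∃ lam : Isogeny W W', lam.degree * ℓ ^ 2 = φ.degree ∧ ∀ P, φ P = lam (ℓ • P) := by
  classical
  have hℓQ : (ℓ : ℚ) ≠ 0 := by exact_mod_cast hℓ
  obtain ⟨lam, hlam⟩ := WeierstrassCurve.Isogeny.exists_eq_comp_nsmul_of_geomTorsion_le_ker_holds'
    W W' hℓQ φ (fun P hP ↦ hle hP)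
  refine ⟨lam, ?_, hlam⟩
  have hcomp : φ.toAddMonoidHom = lam.toAddMonoidHom.comp (nsmulAddMonoidHom ℓ) := by
    ext P; exact hlam P
  have hsurj : Function.Surjective (nsmulAddMonoidHom ℓ : W.geomPoints →+ W.geomPoints) :=
    (W.baseChange (AlgebraicClosure ℚ)).nsmul_surjective_of_isAlgClosed hℓ
  have hkerN : (nsmulAddMonoidHom ℓ : W.geomPoints →+ W.geomPoints).ker = geomTorsion W (ℓ : ℤ) := by
    ext P
    rw [AddMonoidHom.mem_ker, nsmulAddMonoidHom_apply]
    exact AddSubgroup.torsionBy.nsmul_iff.symm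
  have hℓ0 : (ℓ : AlgebraicClosure ℚ) ≠ 0 := by exact_mod_cast hℓ
  have hcardT : Nat.card (geomTorsion W (ℓ : ℤ)) = ℓ ^ 2 :=
    card_torsionBy_eq_sq (E := W.baseChange (AlgebraicClosure ℚ)) hℓ0
  have h := AddMonoidHom.natCard_ker_comp_of_surjective lam.toAddMonoidHom _ hsurj
  rw [← hcomp, hkerN, hcardT] at h
  exact h.symm

/-- **The local input of Lemma 6.8 for an arbitrary `ℚ`-isogeny.** For elliptic curves `W, W'`
over `ℚ`, an isogeny `φ : W → W'` over `ℚ` of degree `n` and a place `v` at which both have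
multiplicative reduction, there are positive integers `a, b` with `a · b ∣ n` and
`c_v(W) · b = c_v(W') · a` (`c_v = ord_v Δ_min`). This is the functoriality argument of the proof
of Lemma 6.8 (p0022: "the maps `Φ_p(A) → Φ_p(B) → Φ_p(A)` induced by `α` and its dual, whose
composition is multiplication by `n`"), here by strong induction on `n` extending the tree's cyclic
case `exists_ordMinimalDiscriminant_mul_eq_mul_of_isCyclic`: degree `1` preserves `j` hence `c_v`;
if `E[ℓ] ⊆ ker φ` for the least prime `ℓ ∣ n` then `φ = λ ∘ [ℓ]` with `deg λ = n/ℓ²` and the same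
curves (`Isogeny_exists_eq_comp_nsmul_degree_of_geomTorsion_le_ker`); otherwise `φ = λ ∘ ψ` through
a `ℚ`-rational quotient of degree `ℓ` (`Isogeny_geomTorsion_le_ker_or_exists_factor_of_prime_dvd`),
to which `ordMinimalDiscriminant_eq_mul_or_of_degree_eq_prime` applies, and induction on `λ`.
[cite: PastenShimura2024, Lemma 6.8 and its proof (p0022), §6.4 (p0022)] -/
theorem exists_ordMinimalDiscriminant_mul_eq_mul_of_degree_eq (n : ℕ) :
    ∀ {W W' : WeierstrassCurve ℚ} [W.IsElliptic] [W'.IsElliptic] (φ : Isogeny W W'),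
      φ.degree = n → ∀ v : HeightOneSpectrum ℤ, W.HasMultiplicativeReductionAt v →
        W'.HasMultiplicativeReductionAt v →
          ∃ a b : ℕ, 0 < a ∧ 0 < b ∧ a * b ∣ n ∧
            W.ordMinimalDiscriminant v * b = W'.ordMinimalDiscriminant v * a := by
  induction n using Nat.strong_induction_on with
  | _ n ih =>
    intro W W' _ _ φ hdeg v hv hv'
    by_cases h1 : n = 1
    · -- degree `1`: same `j`, same `c_v`
      subst h1
      refine ⟨1, 1, one_pos, one_pos, by norm_num, ?_⟩
      have hj := φ.j_eq_of_degree_eq_one hdeg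
      have h := valuation_j_eq_exp_ordMinimalDiscriminant W v hv
      rw [hj, valuation_j_eq_exp_ordMinimalDiscriminant W' v hv', WithZero.exp_inj] at h
      rw [mul_one, mul_one]
      exact_mod_cast h.symm
    · have hn0 : n ≠ 0 := by rw [← hdeg]; exact φ.degree_pos.ne'
      have hn1 : 1 < n := by omega
      set ℓ := n.minFac with hℓdef
      have hℓ : ℓ.Prime := Nat.minFac_prime h1
      have hℓn : ℓ ∣ n := Nat.minFac_dvd n
      rcases Isogeny_geomTorsion_le_ker_or_exists_factor_of_prime_dvd φ hℓ (hdeg ▸ hℓn) with hle | hfac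
      · -- `φ = λ ∘ [ℓ]`, same curves, `deg λ = n / ℓ²`
        obtain ⟨lam, hlamdeg, -⟩ :=
          Isogeny_exists_eq_comp_nsmul_degree_of_geomTorsion_le_ker φ hℓ.ne_zero hle
        rw [hdeg] at hlamdeg
        have hlt : lam.degree < n := by
          have h4 : 4 ≤ ℓ ^ 2 := by have h2 := hℓ.two_le; nlinarith
          have hpos := lam.degree_pos
          calc lam.degree < lam.degree * 4 := by omega
            _ ≤ lam.degree * ℓ ^ 2 := Nat.mul_le_mul_left _ h4
            _ = n := hlamdeg
        obtain ⟨a, b, ha, hb, hab, heq⟩ := ih lam.degree hlt lam rfl v hv hv'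
        exact ⟨a, b, ha, hb, hab.trans ⟨ℓ ^ 2, hlamdeg.symm⟩, heq⟩
      · obtain ⟨W'', hW'', ψ, lam, hψdeg, hlamdeg, -⟩ := hfac
        haveI := hW''
        rw [hdeg] at hlamdeg
        have hv'' : W''.HasMultiplicativeReductionAt v :=
          hasMultiplicativeReductionAt_of_isIsogenous ⟨ψ⟩ v hv
        -- the prime step for `ψ` and the induction hypothesis for `λ`
        have hstep := ordMinimalDiscriminant_eq_mul_or_of_degree_eq_prime ψ hℓ hψdeg v hv hv''
        have hlt : lam.degree < n := by
          have h2 := hℓ.two_le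
          have hpos := lam.degree_pos
          nlinarith
        obtain ⟨a, b, ha, hb, hab, heq⟩ := ih lam.degree hlt lam rfl v hv'' hv'
        rcases hstep with hs | hs
        · -- `c = ℓ c''`: `c · b = ℓ c'' b = ℓ a c'`
          refine ⟨ℓ * a, b, Nat.mul_pos hℓ.pos ha, hb, ?_, ?_⟩
          · rw [← hlamdeg, show ℓ * a * b = a * b * ℓ by ring]
            exact Nat.mul_dvd_mul_right hab ℓ
          · rw [hs, mul_assoc, heq]; ring
        · -- `c'' = ℓ c`: `c · (ℓ b) = c'' b = c' a`
          refine ⟨a, ℓ * b, ha, Nat.mul_pos hℓ.pos hb, ?_, ?_⟩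
          · rw [← hlamdeg, show a * (ℓ * b) = a * b * ℓ by ring]
            exact Nat.mul_dvd_mul_right hab ℓ
          · rw [← heq, hs]; ring

/-- **`p ∥ N` means multiplicative reduction at the place `v_p` of `ℤ`.** For an elliptic curve
`W/ℚ` and a prime `p` dividing the conductor `N_W` exactly once, `W` has multiplicative reduction at
`v_p = primesEquiv.symm p`: `f_p = v_p(N_W) = 1` (`N_W = ∏ p^{f_p}`, tree
`factorization_conductorNorm_holds`) and `f_v = 1 ↔` multiplicative reduction (Silverman *ATAEC*
IV.10.2(b), tree `conductorExponent_eq_one_iff_holds`). (The translation step of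
`lemma_6_8_factorization_form`, `ShimuraCurveRibetTakahashiAssemblyProofs`; Pasten §2 p. 12: the
primes `p ∥ N` are "the primes of multiplicative reduction".)
[cite: PastenShimura2024, §2 (p. 12)] [cite: SilvermanATAEC1994, Thm. IV.10.2(b)] -/
theorem hasMultiplicativeReductionAt_primesEquiv_symm_of_dvd_of_not_sq_dvd
    (W : WeierstrassCurve ℚ) [W.IsElliptic] {p : ℕ} (hp : p.Prime)
    (hpN : p ∣ W.conductorNorm ℤ) (hp2 : ¬ p ^ 2 ∣ W.conductorNorm ℤ) :
    W.HasMultiplicativeReductionAt ((Rat.HeightOneSpectrum.primesEquiv (R := ℤ)).symm ⟨p, hp⟩) := by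
  set v : HeightOneSpectrum ℤ := (Rat.HeightOneSpectrum.primesEquiv (R := ℤ)).symm ⟨p, hp⟩
    with hv
  have hgen : Rat.HeightOneSpectrum.natGenerator v = p := natGenerator_primesEquiv_symm hp
  have hN0 : W.conductorNorm ℤ ≠ 0 := fun h0 => hp2 (h0 ▸ dvd_zero _)
  have hfac : (W.conductorNorm ℤ).factorization p = 1 := by
    have h1 : 0 < (W.conductorNorm ℤ).factorization p := hp.factorization_pos_of_dvd hN0 hpN
    have h2 : ¬ 2 ≤ (W.conductorNorm ℤ).factorization p := fun h =>
      hp2 ((hp.pow_dvd_iff_le_factorization hN0).mpr h)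
    omega
  have hf : W.conductorExponent v = 1 := by
    have h := W.factorization_conductorNorm_holds v
    rw [hgen] at h
    rw [← h, hfac]
  exact (WeierstrassCurve.conductorExponent_eq_one_iff_holds v W).mp hf

/-- **Discharge of the named fact `PastenShimura2024_lemma_6_8_isogeny`** (Lemma 6.8 in
functoriality form): at a prime `p ∥ N_A` the curve `A` — and the `ℚ`-isogenous `B` — has
multiplicative reduction (`f_p = 1`, Silverman *ATAEC* IV.10.2(b): tree
`factorization_conductorNorm_holds`, `conductorExponent_eq_one_iff_holds`,
`hasMultiplicativeReductionAt_of_isIsogenous`), `c_p = v_p(Δ_min) = ord_{v_p} Δ_min` (tree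
`factorization_minimalDiscriminantNorm_holds`), and `exists_ordMinimalDiscriminant_mul_eq_mul_of_degree_eq`
gives `a, b ≥ 1` with `ab ∣ deg α` and `c_p(A) b = a c_p(B)`.
[cite: PastenShimura2024, Lemma 6.8 and its proof (p0022), with §6.4 (p0022)] -/
theorem PastenShimura2024_lemma_6_8_isogeny_holds : PastenShimura2024_lemma_6_8_isogeny := by
  intro A B _ _ α p hp hpN hp2
  set v : HeightOneSpectrum ℤ := (Rat.HeightOneSpectrum.primesEquiv (R := ℤ)).symm ⟨p, hp⟩
    with hv
  have hgen : Rat.HeightOneSpectrum.natGenerator v = p := natGenerator_primesEquiv_symm hp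
  -- `p ∥ N_A`: `A`, and the isogenous `B`, are multiplicative at `v`
  have hmult : A.HasMultiplicativeReductionAt v :=
    hasMultiplicativeReductionAt_primesEquiv_symm_of_dvd_of_not_sq_dvd A hp hpN hp2
  have hmult' : B.HasMultiplicativeReductionAt v :=
    hasMultiplicativeReductionAt_of_isIsogenous ⟨α⟩ v hmult
  obtain ⟨a, b, ha, hb, hab, heq⟩ :=
    exists_ordMinimalDiscriminant_mul_eq_mul_of_degree_eq α.degree α rfl v hmult hmult'
  -- `ord_v Δ_min = v_p(|Δ_min|)` for `A` and `B`
  have hΔ : (A.minimalDiscriminantNorm ℤ).factorization p = A.ordMinimalDiscriminant v := by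
    have h := A.factorization_minimalDiscriminantNorm_holds v
    rwa [hgen] at h
  have hΔ' : (B.minimalDiscriminantNorm ℤ).factorization p = B.ordMinimalDiscriminant v := by
    have h := B.factorization_minimalDiscriminantNorm_holds v
    rwa [hgen] at h
  refine ⟨a, b, ha, hb, (dvd_mul_right a b).trans hab, (dvd_mul_left b a).trans hab, ?_⟩
  rw [hΔ, hΔ', heq, mul_comm]

end Lemma68Discharge

/-! ### An isogeny of degree prime to `p` when `E[p]` is irreducible; Lemma 6.8 `p`-adically -/

section PrimeToPIsogeny

open IsDedekindDomain WeierstrassCurve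
open Literature.NumberTheory.EllipticCurves (natGenerator_primesEquiv_symm)
open Literature.NumberTheory.EllipticCurves.ModularForms (hasMultiplicativeReductionAt_of_isIsogenous)

/-- **`E[p]` irreducible and `p ∣ deg φ` force `E[p] ⊆ ker φ`.** For an isogeny `φ : W → W'` of
elliptic curves over `ℚ`, a prime `p ∣ deg φ` and `E[p]` an irreducible `Γ_ℚ`-module
(`HasIrreducibleModPGaloisRep`: the only `Γ_ℚ`-stable subgroups of `E[p]` are `0` and `E[p]`):
`E[p] ⊆ ker φ`. Otherwise (`Isogeny_geomTorsion_le_ker_or_exists_factor_of_prime_dvd`) `φ` factors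
through a `ℚ`-rational quotient `ψ : W → W''` of degree `p`, whose kernel is a `Γ_ℚ`-stable subgroup
of `E[p]` of order `p` — neither `0` nor `E[p]` (order `p²`, Cor. III.6.4(b)); in Greenberg's words
"`E[p]` is reducible as a `G_ℚ`-module, i.e., `E` admits a cyclic `ℚ`-isogeny of degree `p`".
[cite: GreenbergLNM1716, §5 (the μ-invariant discussion; PDF p0137 of LNM 1716): "E[p] is reducible as a G_Q-module, i.e., E admits a cyclic Q-isogeny of degree p"]
[cite: SilvermanAEC2009, Prop. III.4.12 with Rem. III.4.13.2, Cor. III.6.4(b)] -/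
theorem Isogeny_geomTorsion_le_ker_of_irreducible_of_prime_dvd {W W' : WeierstrassCurve ℚ}
    [W.IsElliptic] [W'.IsElliptic] (φ : Isogeny W W') {p : ℕ} (hp : p.Prime)
    (hirr : W.HasIrreducibleModPGaloisRep p) (hdvd : p ∣ φ.degree) :
    geomTorsion W (p : ℤ) ≤ φ.toAddMonoidHom.ker := by
  classical
  rcases Isogeny_geomTorsion_le_ker_or_exists_factor_of_prime_dvd φ hp hdvd with hle | hfac
  · exact hle
  exfalso
  obtain ⟨W'', hW'', ψ, -, hψdeg, -, -⟩ := hfac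
  haveI := hW''
  -- `ker ψ ⊆ E[p]`: every element of a group of order `p` is killed by `p`
  haveI : Finite ψ.toAddMonoidHom.ker := ψ.finite_ker
  have hkerle : ψ.toAddMonoidHom.ker ≤ geomTorsion W (p : ℤ) := by
    intro x hx
    have h1 := addOrderOf_dvd_natCard (G := ψ.toAddMonoidHom.ker) ⟨x, hx⟩
    rw [← AddSubgroup.addOrderOf_coe] at h1
    change addOrderOf x ∣ ψ.degree at h1
    rw [hψdeg] at h1
    exact AddSubgroup.torsionBy.nsmul_iff.mpr (addOrderOf_dvd_iff_nsmul_eq_zero.mp h1)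
  -- as a subgroup `H` of `E[p]`: `Γ_ℚ`-stable of order `p`
  set H : AddSubgroup (geomTorsion W (p : ℤ)) :=
    ψ.toAddMonoidHom.ker.addSubgroupOf (geomTorsion W (p : ℤ)) with hH
  have hcardH : Nat.card H = p := by
    rw [hH, Nat.card_congr (AddSubgroup.addSubgroupOfEquivOfLe hkerle).toEquiv]
    exact hψdeg
  have hstab : ∀ σ : Field.absoluteGaloisGroup ℚ, ∀ P ∈ H, σ • P ∈ H := fun σ P hP ↦ by
    rw [hH, AddSubgroup.mem_addSubgroupOf, AddMonoidHom.mem_ker, Isogeny.coe_toAddMonoidHom] at hP ⊢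
    rw [Literature.NumberTheory.EllipticCurves.AddSubgroup.torsionBy.coe_smul, ψ.map_smul, hP,
      smul_zero]
  -- `#E[p] = p²`
  have hp0 : (p : AlgebraicClosure ℚ) ≠ 0 := by exact_mod_cast hp.ne_zero
  have hcardT : Nat.card (geomTorsion W (p : ℤ)) = p ^ 2 :=
    card_torsionBy_eq_sq (E := W.baseChange (AlgebraicClosure ℚ)) hp0
  haveI : Finite (geomTorsion W (p : ℤ)) := Nat.finite_of_card_ne_zero (by
    rw [hcardT]; exact pow_ne_zero 2 hp.ne_zero)
  rcases hirr H hstab with hbot | htop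
  · rw [hbot, AddSubgroup.card_bot] at hcardH
    exact hp.one_lt.ne hcardH
  · rw [htop, AddSubgroup.card_top, hcardT, sq] at hcardH
    exact hp.one_lt.ne' (mul_right_cancel₀ hp.ne_zero (hcardH.trans (one_mul p).symm))

/-- **Isogenous curves with `E[p]` irreducible are joined by an isogeny of degree prime to `p`.**
For `ℚ`-isogenous elliptic curves `W, W'` and a prime `p` with `E[p] = W[p]` an irreducible
`Γ_ℚ`-module there is an isogeny `W → W'` over `ℚ` of degree prime to `p`: starting from any
isogeny `φ`, while `p ∣ deg φ` one has `E[p] ⊆ ker φ`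
(`Isogeny_geomTorsion_le_ker_of_irreducible_of_prime_dvd`), so `φ = λ ∘ [p]` with
`deg λ = deg φ / p²` (Cor. III.4.11 with Cor. III.5.4;
`Isogeny_exists_eq_comp_nsmul_degree_of_geomTorsion_le_ker`); induction on the degree. (The usual
source of such an isogeny in print is Mazur–Kenku's cyclic isogeny; irreducibility alone suffices —
Ribet–Takahashi 1997 §1, verbatim: "The irreducibility hypothesis on `A[ℓ]` implies that any rational
isogeny `A → A′` of degree divisible by `ℓ` factors through the multiplication-by-`ℓ` map on `A`.
Hence there is an isogeny `ϕ : A → A′` whose degree is prime to `ℓ`." The general-field version is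
the tree's `Literature.NumberTheory.EllipticCurves.exists_isogeny_not_dvd_degree_of_irreducible`
(`SkinnerUrban2014/PAdicUnitPeriodRatioProofs.lean`).)
[cite: RibetTakahashi1997, §1 (paragraph preceding Thm. 1)]
[cite: GreenbergLNM1716, §5 (PDF p0137 of LNM 1716): "E[p] is reducible as a G_Q-module, i.e., E admits a cyclic Q-isogeny of degree p"]
[cite: SilvermanAEC2009, Cor. III.4.11 with Cor. III.5.4, Cor. III.6.4(b)] -/
theorem exists_isogeny_not_dvd_degree_of_hasIrreducibleModPGaloisRep {W W' : WeierstrassCurve ℚ}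
    [W.IsElliptic] [W'.IsElliptic] (h : W.IsIsogenous W') {p : ℕ} (hp : p.Prime)
    (hirr : W.HasIrreducibleModPGaloisRep p) : ∃ φ : Isogeny W W', ¬ p ∣ φ.degree := by
  obtain ⟨φ₀⟩ := h
  suffices key : ∀ (n : ℕ) (φ : Isogeny W W'), φ.degree = n →
      ∃ φ' : Isogeny W W', ¬ p ∣ φ'.degree from key _ φ₀ rfl
  intro n
  induction n using Nat.strong_induction_on with
  | _ n ih =>
    intro φ hdeg
    by_cases hdvd : p ∣ φ.degree
    · have hle := Isogeny_geomTorsion_le_ker_of_irreducible_of_prime_dvd φ hp hirr hdvd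
      obtain ⟨lam, hlamdeg, -⟩ :=
        Isogeny_exists_eq_comp_nsmul_degree_of_geomTorsion_le_ker φ hp.ne_zero hle
      rw [hdeg] at hlamdeg
      have hlt : lam.degree < n := by
        have h4 : 4 ≤ p ^ 2 := by have h2 := hp.two_le; nlinarith
        have hpos := lam.degree_pos
        calc lam.degree < lam.degree * 4 := by omega
          _ ≤ lam.degree * p ^ 2 := Nat.mul_le_mul_left _ h4
          _ = n := hlamdeg
      exact ih lam.degree hlt lam rfl
    · exact ⟨φ, hdvd⟩

/-- **Lemma 6.8 at a prime `p` with `E[p]` irreducible: `c_q(A)` and `c_q(B)` have the same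
`p`-adic valuation.** For `ℚ`-isogenous elliptic curves `A, B`, a prime `p` with `A[p]` irreducible
and a prime `q ∥ N_A`: there are `a, b ≥ 1` prime to `p` with `c_q(A) · b = a · c_q(B)`
(`c_q = v_q(Δ_min)`): the functoriality form of Lemma 6.8 (`PastenShimura2024_lemma_6_8_isogeny_holds`:
numerator and denominator of `c_q(A)/c_q(B)` divide the degree of any isogeny `A → B`) applied to an
isogeny of degree prime to `p` (`exists_isogeny_not_dvd_degree_of_hasIrreducibleModPGaloisRep`).
This is the clause "(P68) … with an isogeny of degree `n` prime to `p` (`E[p]` irreducible)" of the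
BSD consumer's Ribet–Takahashi package, now a theorem.
[cite: PastenShimura2024, Lemma 6.8 and its proof (p0022)]
[cite: GreenbergLNM1716, §5 (PDF p0137 of LNM 1716)] -/
theorem exists_factorization_minimalDiscriminantNorm_mul_eq_mul_not_dvd
    (A B : WeierstrassCurve ℚ) [A.IsElliptic] [B.IsElliptic] (hiso : A.IsIsogenous B)
    {p : ℕ} (hp : p.Prime) (hirr : A.HasIrreducibleModPGaloisRep p)
    (q : ℕ) (hq : q.Prime) (hqN : q ∣ A.conductorNorm ℤ) (hq2 : ¬ q ^ 2 ∣ A.conductorNorm ℤ) :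
    ∃ a b : ℕ, 0 < a ∧ 0 < b ∧ ¬ p ∣ a ∧ ¬ p ∣ b ∧
      (A.minimalDiscriminantNorm ℤ).factorization q * b =
        a * (B.minimalDiscriminantNorm ℤ).factorization q := by
  obtain ⟨φ, hφ⟩ := exists_isogeny_not_dvd_degree_of_hasIrreducibleModPGaloisRep hiso hp hirr
  obtain ⟨a, b, ha, hb, han, hbn, heq⟩ :=
    PastenShimura2024_lemma_6_8_isogeny_holds A B φ q hq hqN hq2
  exact ⟨a, b, ha, hb, fun h => hφ (h.trans han), fun h => hφ (h.trans hbn), heq⟩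

/-- **Corollary: `ord_p c_q(A) = ord_p c_q(B)`** for `ℚ`-isogenous `A, B`, `A[p]` irreducible,
`q ∥ N_A` (from `exists_factorization_minimalDiscriminantNorm_mul_eq_mul_not_dvd`; both `c_q` are
`≥ 1` since `A` and `B` have multiplicative reduction at `q`, Silverman *AEC* VII.5.1(b)).
Ribet–Takahashi 1997 §1, verbatim: "Notice that `ord_ℓ c_p = ord_ℓ c′_p` and `ord_ℓ c_q = ord_ℓ c′_q`
for each prime `ℓ` such that `A[ℓ]` is irreducible. … If `d = deg ϕ`, the map `ϕ` induces an
isomorphism between the prime-to-`d` parts of the component groups of `A` and `A′`."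
[cite: RibetTakahashi1997, §1 (paragraph preceding Thm. 1)]
[cite: PastenShimura2024, Lemma 6.8 and its proof (p0022)] [cite: SilvermanAEC2009, Prop. VII.5.1(b)] -/
theorem padicValNat_factorization_minimalDiscriminantNorm_eq_of_hasIrreducibleModPGaloisRep
    (A B : WeierstrassCurve ℚ) [A.IsElliptic] [B.IsElliptic] (hiso : A.IsIsogenous B)
    {p : ℕ} (hp : p.Prime) (hirr : A.HasIrreducibleModPGaloisRep p)
    (q : ℕ) (hq : q.Prime) (hqN : q ∣ A.conductorNorm ℤ) (hq2 : ¬ q ^ 2 ∣ A.conductorNorm ℤ) :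
    padicValNat p ((A.minimalDiscriminantNorm ℤ).factorization q) =
      padicValNat p ((B.minimalDiscriminantNorm ℤ).factorization q) := by
  haveI : Fact p.Prime := ⟨hp⟩
  obtain ⟨a, b, ha, hb, hpa, hpb, heq⟩ :=
    exists_factorization_minimalDiscriminantNorm_mul_eq_mul_not_dvd A B hiso hp hirr q hq hqN hq2
  -- both `c_q` are non-zero: multiplicative reduction at `v_q`
  set v : HeightOneSpectrum ℤ := (Rat.HeightOneSpectrum.primesEquiv (R := ℤ)).symm ⟨q, hq⟩
    with hv
  have hgen : Rat.HeightOneSpectrum.natGenerator v = q := natGenerator_primesEquiv_symm hq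
  have hmA : A.HasMultiplicativeReductionAt v :=
    hasMultiplicativeReductionAt_primesEquiv_symm_of_dvd_of_not_sq_dvd A hq hqN hq2
  have hmB : B.HasMultiplicativeReductionAt v := hasMultiplicativeReductionAt_of_isIsogenous hiso v hmA
  have hA0 : (A.minimalDiscriminantNorm ℤ).factorization q ≠ 0 := by
    have h := A.factorization_minimalDiscriminantNorm_holds v
    rw [hgen] at h
    rw [h]
    exact WeierstrassCurve.ordMinimalDiscriminant_ne_zero_of_hasMultiplicativeReductionAt v A hmA
  have hB0 : (B.minimalDiscriminantNorm ℤ).factorization q ≠ 0 := by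
    have h := B.factorization_minimalDiscriminantNorm_holds v
    rw [hgen] at h
    rw [h]
    exact WeierstrassCurve.ordMinimalDiscriminant_ne_zero_of_hasMultiplicativeReductionAt v B hmB
  have h := congrArg (padicValNat p) heq
  rw [padicValNat.mul hA0 hb.ne', padicValNat.mul ha.ne' hB0,
    padicValNat.eq_zero_of_not_dvd hpa, padicValNat.eq_zero_of_not_dvd hpb] at h
  simpa using h

/-- **The dual of an isogeny of degree `n` has degree `n`** (Silverman *AEC* Thm. III.6.1(a) with
Thm. III.6.2(e): `φ̂ ∘ φ = [n]`, `deg φ̂ = deg φ`). In the tree's idiom: if `ψ : W' → W` satisfies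
`ψ ∘ φ = [deg φ]` on `ℚ̄`-points (as the dual produced by `Isogeny.exists_dual_of_isElliptic` does),
then `deg ψ · deg φ = #ker [n] = n²` (`n = deg φ`; `φ` is onto `E'(ℚ̄)`, and `#E[n] = n²`,
Cor. III.6.4(b)), so `deg ψ = n`. [cite: SilvermanAEC2009, Thm. III.6.1(a), Thm. III.6.2(e), Cor. III.6.4(b)] -/
theorem Isogeny_degree_eq_of_comp_eq_degree_zsmul {W W' : WeierstrassCurve ℚ} [W.IsElliptic]
    [W'.IsElliptic] (φ : Isogeny W W') (ψ : Isogeny W' W)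
    (h : ∀ P, ψ (φ P) = (φ.degree : ℤ) • P) : ψ.degree = φ.degree := by
  classical
  have hn0 : φ.degree ≠ 0 := φ.degree_pos.ne'
  have hcomp : ψ.toAddMonoidHom.comp φ.toAddMonoidHom =
      DistribSMul.toAddMonoidHom W.geomPoints (φ.degree : ℤ) := by
    ext P; exact h P
  have hker : (DistribSMul.toAddMonoidHom W.geomPoints (φ.degree : ℤ)).ker =
      geomTorsion W (φ.degree : ℤ) := by
    ext P
    rw [AddMonoidHom.mem_ker, DistribSMul.toAddMonoidHom_apply]
    change _ ↔ P ∈ AddSubgroup.torsionBy W.geomPoints (φ.degree : ℤ)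
    rw [AddSubgroup.torsionBy, Submodule.mem_toAddSubgroup, Submodule.mem_torsionBy_iff]
  have hq0 : ((φ.degree : ℕ) : AlgebraicClosure ℚ) ≠ 0 := by exact_mod_cast hn0
  have hcardT : Nat.card (geomTorsion W (φ.degree : ℤ)) = φ.degree ^ 2 :=
    card_torsionBy_eq_sq (E := W.baseChange (AlgebraicClosure ℚ)) hq0
  have hc := AddMonoidHom.natCard_ker_comp_of_surjective ψ.toAddMonoidHom φ.toAddMonoidHom
    φ.surjective
  rw [hcomp, hker, hcardT] at hc
  change φ.degree ^ 2 = ψ.degree * φ.degree at hc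
  rw [sq] at hc
  exact (mul_right_cancel₀ hn0 hc).symm

/-- **An isogeny `W' → W` of degree prime to `p`, from `W ~ W'` and `W[p]` irreducible** (the
direction the Heegner-point display needs: `λ : A_{N⁺,N⁻} → E`): the dual (Thm. III.6.1(a), tree
`Isogeny.exists_dual_of_isElliptic`) of the prime-to-`p` isogeny `W → W'` of
`exists_isogeny_not_dvd_degree_of_hasIrreducibleModPGaloisRep` has the same degree
(`Isogeny_degree_eq_of_comp_eq_degree_zsmul`). Only the irreducibility of `W[p]` is used (not of
`W'[p]`), and no Mazur–Kenku.
[cite: SilvermanAEC2009, Thm. III.6.1(a), Thm. III.6.2(e)]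
[cite: GreenbergLNM1716, §5 (PDF p0137 of LNM 1716)] -/
theorem exists_isogeny_symm_not_dvd_degree_of_hasIrreducibleModPGaloisRep
    {W W' : WeierstrassCurve ℚ} [W.IsElliptic] [W'.IsElliptic] (h : W.IsIsogenous W') {p : ℕ}
    (hp : p.Prime) (hirr : W.HasIrreducibleModPGaloisRep p) :
    ∃ ψ : Isogeny W' W, ¬ p ∣ ψ.degree := by
  obtain ⟨φ, hφ⟩ := exists_isogeny_not_dvd_degree_of_hasIrreducibleModPGaloisRep h hp hirr
  obtain ⟨ψ, hψ⟩ := φ.exists_dual_of_isElliptic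
  exact ⟨ψ, by rwa [Isogeny_degree_eq_of_comp_eq_degree_zsmul φ ψ hψ]⟩

end PrimeToPIsogeny

end Literature.NumberTheory.Automorphic

end
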